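import Summits.ResolutionOfSingularities.ResolutionOfSingularities.Theorems.FrobeniusClosingSteerBetaNewtonStrictTransform
import Summits.ResolutionOfSingularities.ResolutionOfSingularities.Theorems.FrobeniusClosingSteerBetaFaceSupport
import HarnessLib

/-!
# Crux `Steer` (stmt-ResolutionOfSingularities-16345), chain W4.1, β-LEAF, K-β2♭ part (II), file 9: TRANSPORT of `𝐒(f)` along the
# `x`-chart letter at the origin, the FACE-VERTEX transport, and the strict transform (def-free)

OURS (campaign `res-hironaka`, rung L ★L-G4, slot W4.1; statements about the route's own objects; they replace the
role of no printed item and are NOT statements of the manuscript under review [claim: Hironaka2017, status: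
under-review]; AI review is weaker than expert review). Seat res-D-pv-003 (gen 7), K-β2♭ kernel owner — (II-X) C′ (`c = 0`).

Along the `x`-chart substitution at the origin `φ y = φ x · v₁`, `φ z = φ x · z₁`, `φ w = φ x · w₁` the map `φ` is the monomial
substitution `φ (t^a) = t'^{L₀ a}`, `L₀ a = (|a|, a₁, a₂, a₃)`, `t' = (φ x, v₁, z₁, w₁)`; the strict transform `g = φ f / (φ x)^d`
has `𝐒(g) = min (L₀(𝐒(f)) − d·e₀)`, `L a = (|a| − d, a₁, a₂, a₃)` (Cossart–Piltant Prop. 2.6, tree `minExponents_of_mul_pow_eq`).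
The face end `w⁻ = (δ − γ, γ)` upstairs (exponent `((δ − γ)m, γm, i, j)`) transports to the left vertex `(δ − 1, γ)` downstairs.

* `xChart_hrel`, `transportX_apply`, `le_transportX_iff`, `sum_transportX` — bookkeeping.
* `minExponents_strictTransformX` — Prop. 2.6 along the `x`-chart letter.
* `faceVertex_transport_arith`, **`transport_faceVertex_mem_minExponents`** — the transported face-vertex exponent IS a minimal
  exponent of the strict transform, and `δ + γ ≥ 2`.
* `exists_strictTransformX`, **`strictTransform_eq_of_radicand_X`** — `φ f = (φ x)^d · f₁`, `b₁ = b`, `2k + a₁ = a + b + d` from the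
  radicand relation `φ (u · f) = (φ x)^(2k) · (u₁ · f₁)` and the cone clauses.

[cite: CossartPiltant2019, Prop. 2.6] [cite: CossartJannsenSaito2020, Lemma 12.1] No Theses file is imported; nothing here is a
route item or a registration.
-/

noncomputable section

-- `Summit.<S>.<S>.…` duplicates the summit name by design (single-problem summit).
set_option linter.dupNamespace false

namespace Summit.ResolutionOfSingularities.ResolutionOfSingularities.Theorems.SwitchingDichotomy.BetaNewton

open IsLocalRing
open Literature.AlgebraicGeometry.Resolution
open Literature.AlgebraicGeometry.Resolution.CossartPiltant (uPow uPow_mem_span_uPow uPow_mem_span_uPow_of_le minExponents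
  minExponents_of_mul_pow_eq)
open Summit.ResolutionOfSingularities.ResolutionOfSingularities.Theorems.SwitchingDichotomy.BetaPolygon
open Summit.ResolutionOfSingularities.ResolutionOfSingularities.Theorems.SwitchingDichotomy.BetaLetter (range_four)

variable {S S₁ : Type} [CommRing S] [CommRing S₁]

/-! ## §1 Bookkeeping of the `x`-chart monomial substitution at the origin -/

/-- The `x`-chart substitution at the origin in Cossart–Piltant's origin-chart form (`j₀ = 0`, `J = univ`). [folklore] -/
theorem xChart_hrel (φ : S →+* S₁) {x y z w : S} {v₁ z₁ w₁ : S₁} (hy : φ y = φ x * v₁) (hz : φ z = φ x * z₁)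
    (hw : φ w = φ x * w₁) (j : Fin 4) :
    φ (![x, y, z, w] j) = if j ∈ (Finset.univ : Finset (Fin 4)) ∧ j ≠ 0
      then ![φ x, v₁, z₁, w₁] 0 * ![φ x, v₁, z₁, w₁] j else ![φ x, v₁, z₁, w₁] j := by
  fin_cases j <;> simp [hy, hz, hw]

/-- Coordinates of the transported exponent `L a = (|a| − d, a₁, a₂, a₃)`. [folklore] -/
theorem transportX_apply (a : Fin 4 → ℕ) (d : ℕ) :
    (Function.update a 0 (∑ j ∈ (Finset.univ : Finset (Fin 4)), a j) - d • (Pi.single 0 1 : Fin 4 → ℕ)) 0 =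
      a 0 + a 1 + a 2 + a 3 - d ∧
    (Function.update a 0 (∑ j ∈ (Finset.univ : Finset (Fin 4)), a j) - d • (Pi.single 0 1 : Fin 4 → ℕ)) 1 = a 1 ∧
    (Function.update a 0 (∑ j ∈ (Finset.univ : Finset (Fin 4)), a j) - d • (Pi.single 0 1 : Fin 4 → ℕ)) 2 = a 2 ∧
    (Function.update a 0 (∑ j ∈ (Finset.univ : Finset (Fin 4)), a j) - d • (Pi.single 0 1 : Fin 4 → ℕ)) 3 = a 3 := by
  simp [Fin.sum_univ_four]

/-- Comparing an exponent with a transported exponent, coordinatewise. [folklore] -/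
theorem le_transportX_iff (a a' : Fin 4 → ℕ) (d : ℕ) :
    a' ≤ Function.update a 0 (∑ j ∈ (Finset.univ : Finset (Fin 4)), a j) - d • (Pi.single 0 1 : Fin 4 → ℕ) ↔
      a' 0 ≤ a 0 + a 1 + a 2 + a 3 - d ∧ a' 1 ≤ a 1 ∧ a' 2 ≤ a 2 ∧ a' 3 ≤ a 3 := by
  obtain ⟨e0, e1, e2, e3⟩ := transportX_apply a d
  constructor
  · intro h
    exact ⟨(h 0).trans e0.le, (h 1).trans e1.le, (h 2).trans e2.le, (h 3).trans e3.le⟩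
  · rintro ⟨h0, h1, h2, h3⟩ l
    fin_cases l
    · exact h0.trans e0.ge
    · exact h1.trans e1.ge
    · exact h2.trans e2.ge
    · exact h3.trans e3.ge

/-- Total degree of a transported exponent. [folklore] -/
theorem sum_transportX (a : Fin 4 → ℕ) (d : ℕ) :
    ∑ l, (Function.update a 0 (∑ j ∈ (Finset.univ : Finset (Fin 4)), a j) - d • (Pi.single 0 1 : Fin 4 → ℕ)) l =
      (a 0 + a 1 + a 2 + a 3 - d) + a 1 + a 2 + a 3 := by
  obtain ⟨e0, e1, e2, e3⟩ := transportX_apply a d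
  rw [sum_four, e0, e1, e2, e3]

/-! ## §2 `𝐒` of the strict transform -/

/-- **Cossart–Piltant Prop. 2.6 along the `x`-chart letter at the origin**: for `f ∈ 𝔪^d` and `g · (φ x)^d = φ f`, (1) every
minimal exponent of `g` is `L a = (|a| − d, a₁, a₂, a₃)` for some `a ∈ 𝐒(f)`, and (2) every `L a`, `a ∈ 𝐒(f)`, lies above a
minimal exponent of `g`. [cite: CossartPiltant2019, Prop. 2.6] -/
theorem minExponents_strictTransformX [IsLocalRing S] [IsLocalRing S₁] (φ : S →+* S₁) {x y z w : S}
    {v₁ z₁ w₁ : S₁} (ht : IsRsopPart ![x, y, z, w]) (ht' : IsRsopPart ![φ x, v₁, z₁, w₁])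
    (hspan : Ideal.span {x, y, z, w} = maximalIdeal S) (hspan₁ : Ideal.span {φ x, v₁, z₁, w₁} = maximalIdeal S₁)
    (hy : φ y = φ x * v₁) (hz : φ z = φ x * z₁) (hw : φ w = φ x * w₁) {d : ℕ} {f : S} {g : S₁}
    (hfd : f ∈ maximalIdeal S ^ d) (hg : g * φ x ^ d = φ f) :
    (∀ a' ∈ minExponents ![φ x, v₁, z₁, w₁] g, ∃ a ∈ minExponents ![x, y, z, w] f,
        a' = Function.update a 0 (∑ j ∈ (Finset.univ : Finset (Fin 4)), a j) - d • (Pi.single 0 1 : Fin 4 → ℕ)) ∧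
      (∀ a ∈ minExponents ![x, y, z, w] f, ∃ a' ∈ minExponents ![φ x, v₁, z₁, w₁] g,
        a' ≤ Function.update a 0 (∑ j ∈ (Finset.univ : Finset (Fin 4)), a j) - d • (Pi.single 0 1 : Fin 4 → ℕ)) := by
  haveI := ht.isRegularLocalRing
  haveI := ht'.isRegularLocalRing
  haveI : IsDomain S₁ := isDomain_of_isRegularLocalRing S₁
  have hnzd : ∀ y₀ : S₁, ![φ x, v₁, z₁, w₁] 0 * y₀ = 0 → y₀ = 0 := fun y₀ hy₀ =>
    (mul_eq_zero.mp hy₀).resolve_left (ht'.ne_zero 0)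
  have hfi : ∀ a ∈ minExponents ![x, y, z, w] f, d ≤ ∑ j ∈ (Finset.univ : Finset (Fin 4)), a j :=
    (mem_pow_iff_forall_minExponents ht hspan d f).mp hfd
  have hg' : g * ![φ x, v₁, z₁, w₁] 0 ^ d = φ f := by simpa using hg
  exact minExponents_of_mul_pow_eq φ ![x, y, z, w] ![φ x, v₁, z₁, w₁] ht.mem_span_image_of_mul_mem ht.mem_maximalIdeal
    ht'.mem_span_image_of_mul_mem (Finset.mem_univ (0 : Fin 4)) hnzd (xChart_hrel φ hy hz hw)
    (reflects_span_of_local φ hspan hspan₁) hfi hg'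

/-! ## §3 The face-vertex transport -/

/-- **Arithmetic heart of the face-vertex transport.** Let `a = ((δ − γ)m, γm, i, j)` be the FACE VERTEX exponent of its slot
(`m = d − i − j ≥ 1`, `δ ≥ 1`), let `a''` satisfy the `DeltaFaceGe (δ, γ)` exponent condition, and suppose `L a'' ≤ L a`
(`|a''| ≤ |a|`, `a''₁ ≤ a₁`, `a''₂ ≤ a₂`, `a''₃ ≤ a₃`) with `|L a''| ≥ d` (`|a''| + a''₁ + a''₂ + a''₃ ≥ 2d`). Then `a'' = a`.
[folklore] -/
theorem faceVertex_transport_arith {d : ℕ} {δ γ : ℚ} (hδ : 1 ≤ δ) {a a'' : Fin 4 → ℕ}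
    (hzw : a 2 + a 3 < d) (h01 : ((a 0 + a 1 : ℕ) : ℚ) = δ * ((d - a 2 - a 3 : ℕ) : ℚ))
    (h1 : (a 1 : ℚ) = γ * ((d - a 2 - a 3 : ℕ) : ℚ))
    (hG : d ≤ a'' 2 + a'' 3 ∨ ⌊δ * ((d - a'' 2 - a'' 3 : ℕ) : ℚ)⌋₊ + 1 ≤ a'' 0 + a'' 1 ∨
      (⌈δ * ((d - a'' 2 - a'' 3 : ℕ) : ℚ)⌉₊ ≤ a'' 0 + a'' 1 ∧ ⌈γ * ((d - a'' 2 - a'' 3 : ℕ) : ℚ)⌉₊ ≤ a'' 1))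
    (hs : a'' 0 + a'' 1 + a'' 2 + a'' 3 ≤ a 0 + a 1 + a 2 + a 3) (hle1 : a'' 1 ≤ a 1) (h2 : a'' 2 ≤ a 2)
    (h3 : a'' 3 ≤ a 3) (hdeg : 2 * d ≤ a'' 0 + 2 * a'' 1 + 2 * (a'' 2 + a'' 3)) : a'' = a := by
  -- the slots
  set m : ℕ := d - a 2 - a 3 with hm
  set m'' : ℕ := d - a'' 2 - a'' 3 with hm''
  have hm1 : 1 ≤ m := by omega
  have hmm : m ≤ m'' := by omega
  have hzw'' : a'' 2 + a'' 3 < d := by omega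
  have hmQ : (1 : ℚ) ≤ m := by exact_mod_cast hm1
  have hmmQ : (m : ℚ) ≤ m'' := by exact_mod_cast hmm
  push_cast at h01
  -- the sum inequality in slot form: `a''₀ + a''₁ ≤ δ m + m'' − m`
  have hsQ : (a'' 0 : ℚ) + a'' 1 ≤ δ * m + m'' - m := by
    have : a'' 0 + a'' 1 + m ≤ a 0 + a 1 + m'' := by omega
    have : (a'' 0 : ℚ) + a'' 1 + m ≤ a 0 + a 1 + m'' := by exact_mod_cast this
    linarith
  have hδm : δ * (m : ℚ) ≤ δ * m'' := mul_le_mul_of_nonneg_left hmmQ (by linarith)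
  have hδm' : δ * (m'' : ℚ) - δ * m ≥ (m'' : ℚ) - m := by nlinarith
  -- the `DeltaFaceGe` condition at `a''` is the third disjunct
  have hG3 : ⌈δ * (m'' : ℚ)⌉₊ ≤ a'' 0 + a'' 1 ∧ ⌈γ * (m'' : ℚ)⌉₊ ≤ a'' 1 := by
    rcases hG with hG | hG | hG
    · exact absurd hG (by omega)
    · exfalso
      have hlt : δ * (m'' : ℚ) < ((a'' 0 + a'' 1 : ℕ) : ℚ) := by exact_mod_cast Nat.lt_of_floor_lt hG
      push_cast at hlt
      linarith
    · exact hG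
  obtain ⟨hG0, hG1⟩ := hG3
  have hA : δ * (m'' : ℚ) ≤ ((a'' 0 + a'' 1 : ℕ) : ℚ) := Nat.ceil_le.mp hG0
  push_cast at hA
  have hB : γ * (m'' : ℚ) ≤ a'' 1 := Nat.ceil_le.mp hG1
  have hle1Q : (a'' 1 : ℚ) ≤ a 1 := by exact_mod_cast hle1
  -- the degree hypothesis in slot form: `a''₀ + 2 a''₁ ≥ 2 m''`
  have hdegQ : 2 * (m'' : ℚ) ≤ a'' 0 + 2 * a'' 1 := by
    have : 2 * m'' ≤ a'' 0 + 2 * a'' 1 := by omega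
    exact_mod_cast this
  -- `δ + γ ≥ 2` and the slots agree
  have hsum2 : (m'' : ℚ) + m ≤ (δ + γ) * m := by nlinarith
  have hmeq : m'' = m := by
    by_contra hne
    have hlt : (m : ℚ) < m'' := by exact_mod_cast lt_of_le_of_ne hmm (Ne.symm hne)
    -- `δ = 1`-type and `γ = 0`-type squeeze
    have hδ1 : δ * ((m'' : ℚ) - m) ≤ (m'' : ℚ) - m := by linarith
    have hγ0 : γ * ((m'' : ℚ) - m) ≤ 0 := by nlinarith
    have hδone : δ ≤ 1 := le_of_mul_le_mul_right (by linarith) (by linarith : (0 : ℚ) < m'' - m)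
    have hγzero : γ ≤ 0 := by
      by_contra hγpos
      push Not at hγpos
      have : 0 < γ * ((m'' : ℚ) - m) := mul_pos hγpos (by linarith)
      linarith
    have : (m'' : ℚ) + m ≤ m := by nlinarith
    linarith
  have he2 : a'' 2 = a 2 := by omega
  have he3 : a'' 3 = a 3 := by omega
  have hmeqQ : (m'' : ℚ) = m := by exact_mod_cast hmeq
  have he1 : a'' 1 = a 1 := by
    have : (a 1 : ℚ) ≤ a'' 1 := by rw [h1, ← hmeqQ]; exact hB
    exact le_antisymm hle1 (by exact_mod_cast this)
  have he0 : a'' 0 = a 0 := by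
    have hge : (a 0 : ℚ) + a 1 ≤ a'' 0 + a'' 1 := by rw [h01, ← hmeqQ]; exact hA
    have hle : (a'' 0 : ℚ) + a'' 1 ≤ a 0 + a 1 := by rw [h01, ← hmeqQ]; linarith
    have : (a'' 0 : ℚ) = a 0 := by
      have e1 : (a'' 1 : ℚ) = a 1 := by exact_mod_cast he1
      linarith
    exact_mod_cast this
  funext l
  fin_cases l
  · exact he0
  · exact he1
  · exact he2
  · exact he3

/-- **`δ + γ ≥ 2`** at a face vertex whose transported exponent dominates an exponent of total degree `≥ d`. [folklore] -/
theorem two_le_add_of_faceVertex {d : ℕ} {δ γ : ℚ} {a a' : Fin 4 → ℕ} (hzw : a 2 + a 3 < d)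
    (h01 : ((a 0 + a 1 : ℕ) : ℚ) = δ * ((d - a 2 - a 3 : ℕ) : ℚ)) (h1 : (a 1 : ℚ) = γ * ((d - a 2 - a 3 : ℕ) : ℚ))
    (hdeg : d ≤ a 0 + a 1 + a 2 + a 3)
    (hle : a' ≤ Function.update a 0 (∑ j ∈ (Finset.univ : Finset (Fin 4)), a j) - d • (Pi.single 0 1 : Fin 4 → ℕ))
    (hdeg' : d ≤ ∑ l, a' l) : 2 ≤ δ + γ := by
  obtain ⟨h0, h1', h2, h3⟩ := (le_transportX_iff a a' d).mp hle
  rw [sum_four] at hdeg'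
  set m : ℕ := d - a 2 - a 3 with hm
  have hm1 : (1 : ℚ) ≤ m := by exact_mod_cast (show 1 ≤ m by omega)
  have hkeyQ : 2 * (m : ℚ) ≤ (a 0 + a 1) + a 1 := by
    have : 2 * m ≤ a 0 + a 1 + a 1 := by omega
    exact_mod_cast this
  push_cast at h01
  rw [h01, h1] at hkeyQ
  have : 2 * (m : ℚ) ≤ (δ + γ) * m := by linarith
  exact le_of_mul_le_mul_right (by linarith) (by linarith : (0 : ℚ) < m)

/-- **FACE-VERTEX TRANSPORT.** In the `x`-chart transport at the origin, let `a⋆ = ((δ − γ)m, γm, i, j) ∈ 𝐒(f)` be a face-vertex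
exponent (`δ ≥ 1`, `γ ≥ 0`), let every `a ∈ 𝐒(f)` satisfy the `DeltaFaceGe (δ, γ)` condition and have `|a| ≥ d`, and let every
minimal exponent of the strict transform `g` have total degree `≥ d`. Then `L a⋆ = ((δ − 1)m, γm, i, j)` is a minimal exponent
of `g`, and `δ + γ ≥ 2`. [cite: CossartPiltant2019, Prop. 2.6] [cite: CossartJannsenSaito2020, Lemma 12.1] -/
theorem transport_faceVertex_mem_minExponents [IsLocalRing S] [IsLocalRing S₁] (φ : S →+* S₁) {x y z w : S}
    {v₁ z₁ w₁ : S₁} (ht : IsRsopPart ![x, y, z, w]) (ht' : IsRsopPart ![φ x, v₁, z₁, w₁])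
    (hspan : Ideal.span {x, y, z, w} = maximalIdeal S) (hspan₁ : Ideal.span {φ x, v₁, z₁, w₁} = maximalIdeal S₁)
    (hy : φ y = φ x * v₁) (hz : φ z = φ x * z₁) (hw : φ w = φ x * w₁) {d : ℕ} {f : S} {g : S₁}
    (hfd : f ∈ maximalIdeal S ^ d) (hg : g * φ x ^ d = φ f) (hgd : g ∈ maximalIdeal S₁ ^ d)
    {δ γ : ℚ} (hδ : 1 ≤ δ) (hγ : 0 ≤ γ) (hG : DeltaFaceGe x y z w d δ γ f)
    {a : Fin 4 → ℕ} (ha : a ∈ minExponents ![x, y, z, w] f) (hzw : a 2 + a 3 < d)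
    (h01 : ((a 0 + a 1 : ℕ) : ℚ) = δ * ((d - a 2 - a 3 : ℕ) : ℚ)) (h1 : (a 1 : ℚ) = γ * ((d - a 2 - a 3 : ℕ) : ℚ)) :
    (Function.update a 0 (∑ j ∈ (Finset.univ : Finset (Fin 4)), a j) - d • (Pi.single 0 1 : Fin 4 → ℕ)) ∈
        minExponents ![φ x, v₁, z₁, w₁] g ∧ 2 ≤ δ + γ := by
  obtain ⟨hh1, hh2⟩ := minExponents_strictTransformX φ ht ht' hspan hspan₁ hy hz hw hfd hg
  have hdegs := (mem_pow_iff_forall_minExponents ht hspan d f).mp hfd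
  have hdegs' := (mem_pow_iff_forall_minExponents ht' hspan₁ d g).mp hgd
  have hGs := forall_minExponents_of_deltaFaceGe ht (by linarith) hγ hG
  obtain ⟨a', ha', hle⟩ := hh2 a ha
  obtain ⟨a'', ha'', rfl⟩ := hh1 a' ha'
  have hdeg : d ≤ a 0 + a 1 + a 2 + a 3 := by rw [← sum_four]; exact hdegs a ha
  have htwo := two_le_add_of_faceVertex hzw h01 h1 hdeg hle (hdegs' _ ha')
  obtain ⟨k0, k1, k2, k3⟩ := (le_transportX_iff a _ d).mp hle
  obtain ⟨f0, f1, f2, f3⟩ := transportX_apply a'' d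
  rw [f0] at k0; rw [f1] at k1; rw [f2] at k2; rw [f3] at k3
  have hdeg'' : d ≤ a'' 0 + a'' 1 + a'' 2 + a'' 3 := by rw [← sum_four]; exact hdegs a'' ha''
  have hdegL := hdegs' _ ha'
  rw [sum_transportX] at hdegL
  have heq : a'' = a :=
    faceVertex_transport_arith hδ hzw h01 h1 (hGs a'' ha'') (by omega) k1 k2 k3 (by omega)
  subst heq
  exact ⟨ha', htwo⟩

/-! ## §4 The strict transform along the `x`-chart letter -/

/-- Along the `x`-chart substitution, `φ (x, y, z, w)^d ⊆ ((φ x)^d)`. [cite: CossartJannsenSaito2020, Lemma 12.1] -/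
theorem exists_strictTransformX (φ : S →+* S₁) {x y z w : S} {v₁ z₁ w₁ : S₁} (hy : φ y = φ x * v₁)
    (hz : φ z = φ x * z₁) (hw : φ w = φ x * w₁) {d : ℕ} {f : S} (hfd : f ∈ Ideal.span {x, y, z, w} ^ d) :
    ∃ g : S₁, φ f = φ x ^ d * g := by
  have hmap : Ideal.map φ (Ideal.span {x, y, z, w}) ≤ Ideal.span {φ x} := by
    rw [Ideal.map_span, Ideal.span_le]
    rintro _ ⟨t, ht, rfl⟩
    simp only [Set.mem_insert_iff, Set.mem_singleton_iff] at ht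
    rcases ht with rfl | rfl | rfl | rfl
    · exact Ideal.mem_span_singleton_self _
    · exact hy ▸ Ideal.mul_mem_right _ _ (Ideal.mem_span_singleton_self _)
    · exact hz ▸ Ideal.mul_mem_right _ _ (Ideal.mem_span_singleton_self _)
    · exact hw ▸ Ideal.mul_mem_right _ _ (Ideal.mem_span_singleton_self _)
  have h : φ f ∈ Ideal.span {φ x ^ d} := by
    rw [← Ideal.span_singleton_pow]
    refine Ideal.pow_right_mono hmap d ?_
    rw [← Ideal.map_pow]
    exact Ideal.mem_map_of_mem φ hfd
  obtain ⟨g, hg⟩ := Ideal.mem_span_singleton'.mp h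
  exact ⟨g, by rw [← hg, mul_comm]⟩

/-- **`φ f = (φ x)^d · f₁` from the RADICAND RELATION, `x`-chart at the origin.** If `φ f = (φ x)^d · g` with minimal exponents of
`g` and of `f₁` having vanishing `x`- and `v₁`-coordinates (cone clauses), and `φ (u · f) = (φ x)^(2k) · (u₁ · f₁)` with
`u = x^a y^b`, `u₁ = (φ x)^a₁ v₁^b₁`, then `g = f₁`, `b₁ = b` and `2k + a₁ = a + b + d`. [cite: CossartJannsenSaito2020, Lemma 12.1] -/
theorem strictTransform_eq_of_radicand_X [IsLocalRing S₁] (φ : S →+* S₁) {x y u f : S} {v₁ z₁ w₁ u₁ f₁ g : S₁}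
    (ht' : IsRsopPart ![φ x, v₁, z₁, w₁]) (hy : φ y = φ x * v₁) {d k a b a₁ b₁ : ℕ}
    (hu : u = x ^ a * y ^ b) (hu₁ : u₁ = φ x ^ a₁ * v₁ ^ b₁) (hg : φ f = φ x ^ d * g)
    (hrad : φ (u * f) = φ x ^ (2 * k) * (u₁ * f₁))
    {ag : Fin 4 → ℕ} (hag : ag ∈ minExponents ![φ x, v₁, z₁, w₁] g) (hag0 : ag 0 = 0) (hag1 : ag 1 = 0)
    {af : Fin 4 → ℕ} (haf : af ∈ minExponents ![φ x, v₁, z₁, w₁] f₁) (haf0 : af 0 = 0) (haf1 : af 1 = 0) :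
    g = f₁ ∧ b₁ = b ∧ 2 * k + a₁ = a + b + d := by
  haveI := ht'.isRegularLocalRing
  haveI : IsDomain S₁ := isDomain_of_isRegularLocalRing S₁
  have hpx : Prime (φ x) := by simpa using ht'.prime 0
  have hpv : Prime v₁ := by simpa using ht'.prime 1
  have hxv : ¬ v₁ ∣ φ x := by simpa using ht'.not_dvd (i := 1) (j := 0) (by decide)
  have hxg : ¬ φ x ∣ g := by simpa using not_dvd_of_mem_minExponents ht' hag (l := 0) hag0
  have hvg : ¬ v₁ ∣ g := by simpa using not_dvd_of_mem_minExponents ht' hag (l := 1) hag1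
  have hxf : ¬ φ x ∣ f₁ := by simpa using not_dvd_of_mem_minExponents ht' haf (l := 0) haf0
  have hvf : ¬ v₁ ∣ f₁ := by simpa using not_dvd_of_mem_minExponents ht' haf (l := 1) haf1
  have H : v₁ ^ b * φ x ^ (a + b + d) * g = v₁ ^ b₁ * φ x ^ (2 * k + a₁) * f₁ := by
    have h1 : φ (u * f) = v₁ ^ b * φ x ^ (a + b + d) * g := by
      rw [map_mul, hu, map_mul, map_pow, map_pow, hy, hg]; ring
    rw [← h1, hrad, hu₁]; ring
  obtain ⟨h1, h2, h3⟩ := eq_of_prime_pow_mul_eq hpv hpx hxv hvg hvf hxg hxf H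
  exact ⟨h3, h1.symm, h2.symm⟩

end Summit.ResolutionOfSingularities.ResolutionOfSingularities.Theorems.SwitchingDichotomy.BetaNewton

end
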